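import Summits.ResolutionOfSingularities.ResolutionOfSingularities.Theorems.MarkedTransferCampaignW46MohWindowSurfaceStep
import Summits.ResolutionOfSingularities.ResolutionOfSingularities.Theorems.MarkedTransferCampaignW46MohWindowSurfacePerfect
import Mathlib.Data.Multiset.DershowitzManna
import HarnessLib

/-!
# [OURS · L1 W4.6 rung (iii-2), piece (T)] THE TYPED Th. 16.6 PROCEDURE TERMINATES IN THE TAME SURFACE MOH WINDOW — the
# Dershowitz–Manna descent of the multiset of residual orders and the closers of res-L1-type-o1's rung statements
# (cell res-hironaka, LADDER-RESOLUTION rung L, D-0089; unit res-L1-s46-pv-12 carried by res-D-pv-050; host MarkedTransfer,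
# `--supports stmt-ResolutionOfSingularities-16155 --as helper`)

HONEST FRAMING. Nothing here is a statement of H. Hironaka's manuscript [Hironaka2017] and nothing here asserts that any statement of
it holds. THEOREMS about the OURS regime `CampaignW46.Regime.mohWindowSurfaceTame` and the OURS rung statements
`CampaignW46.MohWindowSurfaceTameTerminates[Nabla][Perfect]` (res-L1-type-o1, `…W46MohWindowSurface.lean` §5, `…Perfect.lean`): along a
run of the typed procedure all of whose stages lie in the regime, the MULTISET of residual orders (o1's `residualOrder`, §6) over the
finite singular locus strictly decreases in the Dershowitz–Manna order at every step (`…Step.lean`: it drops at every singular point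
over the blown-up point and is transported elsewhere), and that order is well founded (Mathlib `Multiset.wellFounded_isDershowitzMannaLT`)
— so there is NO infinite run: `mohWindowSurfaceTameTerminates_holds`, for EVERY notion instance `N`, reading `Rd`, prime `p` and
field `K` of characteristic `p`. The HEAVY-ROOT case (a κ-rational linear factor of multiplicity `≥ p` of the residue binary form)
is excluded by the regime and is res-D-pv-008 AS res-L1-s46-pv-14's piece (H) (its growth witness shows the exclusion is necessary for
this invariant); non-vacuity is res-D-pv-029 AS res-L1-s46-pv-13's piece (NV) (`…Instance[Tame].lean`). AI-written; AI review is weaker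
than expert review. No `sorry`; axioms standard. [folklore]
-/

noncomputable section

set_option linter.dupNamespace false -- mandated namespace of this single-conjunct summit

open CategoryTheory AlgebraicGeometry TopologicalSpace IsLocalRing

namespace Summit.ResolutionOfSingularities.ResolutionOfSingularities.Theorems

namespace CampaignW46

open Literature.AlgebraicGeometry.Resolution
open Literature.AlgebraicGeometry.Hironaka2017.S02Preliminaries
open Literature.AlgebraicGeometry.Hironaka2017.Datum
open Scheme.IdealSheafData

universe u

section Proof

variable {n : ℕ} {p : ℕ} [Fact p.Prime] {K : Type u} [Field K] [CharP K p]
variable {N : Notions.{u} n} {A A' : AmbientDatum p K} {E : IdealExponent A.Z} {R : Resume N A E}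

/-- No infinite strictly descending chain for a well-founded relation. [folklore] -/
theorem false_of_descending_chain {α : Type*} {r : α → α → Prop} (hwf : WellFounded r) (f : ℕ → α)
    (hf : ∀ k, r (f (k + 1)) (f k)) : False := by
  obtain ⟨a, ⟨k, rfl⟩, hmin⟩ := hwf.has_min (Set.range f) ⟨f 0, 0, rfl⟩
  exact hmin (f (k + 1)) ⟨k + 1, rfl⟩ (hf k)

/-- **[OURS · L1 W4.6 rung (iii-2)] ONE STEP DROPS THE MULTISET OF RESIDUAL ORDERS** (Dershowitz–Manna): for a step `s` from a state
`(A, E)` of the tame surface window whose transform `(A′, E′)` is again in it, the multiset `{residualOrder J′_{ξ′} : ξ′ ∈ Sing(E′)}` is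
`<_DM` `{residualOrder J_ξ : ξ ∈ Sing(E)}`: remove the value at the blown-up point `ξ`, add the (smaller) values at the singular points
over `ξ`, keep the rest. NOT a statement of the manuscript. [folklore] -/
theorem Step.isDershowitzMannaLT_of_mohWindowSurfaceTame (s : Step R A') (hRg : Regime.mohWindowSurfaceTame A E)
    (hRg' : Regime.mohWindowSurfaceTame A' s.E') :
    Multiset.IsDershowitzMannaLT
      ((hRg'.sing_finite.toFinset.val).map fun ξ' =>
        (residualOrder s.E'.b (A'.Z.presheaf.stalk ξ') (stalkIdeal s.E'.J ξ')).toNat)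
      ((hRg.sing_finite.toFinset.val).map fun ξ =>
        (residualOrder E.b (A.Z.presheaf.stalk ξ) (stalkIdeal E.J ξ)).toNat) := by
  classical
  obtain ⟨ξ, hξS, hξcl, hDξ⟩ := s.centre.exists_eq_singleton_of_mohWindowSurfaceTame hRg
  set val : A.Z → ℕ := fun η => (residualOrder E.b (A.Z.presheaf.stalk η) (stalkIdeal E.J η)).toNat with hval
  set val' : A'.Z → ℕ := fun η => (residualOrder s.E'.b (A'.Z.presheaf.stalk η) (stalkIdeal s.E'.J η)).toNat with hval'
  set S : Finset A.Z := hRg.sing_finite.toFinset with hS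
  set S' : Finset A'.Z := hRg'.sing_finite.toFinset with hS'
  set Son : Finset A'.Z := S'.filter fun x' => s.π.base x' = ξ with hSon
  set Soff : Finset A'.Z := S'.filter fun x' => ¬ s.π.base x' = ξ with hSoff
  have hξmem : ξ ∈ S := by rw [hS, Set.Finite.mem_toFinset]; exact hξS
  have hmemS' : ∀ x', x' ∈ S' ↔ x' ∈ s.E'.sing := fun x' => by rw [hS', Set.Finite.mem_toFinset]
  -- split `M = X + Y`
  have hsplit : S'.val.map val' = Soff.val.map val' + Son.val.map val' := by
    rw [← Multiset.map_add, hSoff, hSon, Finset.filter_val, Finset.filter_val, add_comm, Multiset.filter_add_not]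
  -- off the centre: `X ≤` the multiset of `E` without the blown-up point
  have hoff : ∀ x' ∈ Soff, s.π.base x' ∉ (s.D : Set A.Z) := fun x' hx' => by
    rw [hSoff, Finset.mem_filter] at hx'
    rw [hDξ]; exact hx'.2
  have hinj : Set.InjOn s.π.base (Soff : Set A'.Z) :=
    (MohWindow.injOn_preimage_compl s.blowup).mono fun x' hx' => hoff x' hx'
  have himage : Soff.image s.π.base ⊆ S.erase ξ := by
    intro η hη
    obtain ⟨x', hx', rfl⟩ := Finset.mem_image.mp hη
    have hx'S : x' ∈ s.E'.sing := (hmemS' x').mp (Finset.mem_filter.mp hx').1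
    refine Finset.mem_erase.mpr ⟨?_, ?_⟩
    · have := hoff x' hx'; rw [hDξ] at this; exact this
    · rw [hS, Set.Finite.mem_toFinset]
      exact s.base_mem_sing_of_not_over_centre hx'S (hoff x' hx')
  have hXle : Soff.val.map val' ≤ (S.erase ξ).val.map val := by
    have h1 : Soff.val.map val' = (Soff.val.map s.π.base).map val := by
      rw [Multiset.map_map]
      refine Multiset.map_congr rfl fun x' hx' => ?_
      have hx'' : x' ∈ Soff := hx'
      simp only [hval, hval', Function.comp_apply]
      rw [s.residualOrder_eq_of_not_over_centre (hoff x' hx'')]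
    rw [h1, ← Finset.image_val_of_injOn hinj]
    exact Multiset.map_le_map (Finset.val_le_iff.mpr himage)
  have hSval : S.val.map val = (S.erase ξ).val.map val + {val ξ} := by
    conv_lhs => rw [← Finset.insert_erase hξmem]
    rw [Finset.insert_val_of_notMem (Finset.notMem_erase ξ S), Multiset.map_cons, add_comm, Multiset.singleton_add]
  have hXleN : Soff.val.map val' ≤ S.val.map val := by
    rw [hSval]; exact hXle.trans (Multiset.le_add_right _ _)
  have hZ : S.val.map val - Soff.val.map val' = ((S.erase ξ).val.map val - Soff.val.map val') + {val ξ} := by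
    rw [hSval, add_comm ((S.erase ξ).val.map val), add_tsub_assoc_of_le hXle, add_comm]
  refine ⟨Soff.val.map val', Son.val.map val', S.val.map val - Soff.val.map val', ?_, hsplit, ?_, ?_⟩
  · rw [hZ]
    exact fun h => by simpa using congrArg (fun m => val ξ ∈ m) h
  · rw [add_tsub_cancel_of_le hXleN]
  · intro y hy
    obtain ⟨x', hx', rfl⟩ := Multiset.mem_map.mp hy
    have hx'f := Finset.mem_filter.mp hx'
    have hx'S : x' ∈ s.E'.sing := (hmemS' x').mp hx'f.1
    refine ⟨val ξ, ?_, ?_⟩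
    · rw [hZ]; exact Multiset.mem_add.mpr (Or.inr (Multiset.mem_singleton_self _))
    · have hover : s.π.base x' ∈ (s.D : Set A.Z) := by rw [hDξ]; exact hx'f.2
      have := s.residualOrder_lt_of_over_centre hRg hRg' hx'S hover
      rw [hx'f.2] at this
      exact this

/-- **[OURS · L1 W4.6 rung (iii-2)] THE TYPED Th. 16.6 PROCEDURE TERMINATES IN THE TAME SURFACE MOH WINDOW**, for every notion
instance and every reading: along a run all of whose stages lie in the regime the multiset of residual orders would descend forever in
the (well-founded) Dershowitz–Manna order. NOT a statement of the manuscript. [folklore] -/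
theorem terminates_mohWindowSurfaceTame (N : Notions.{u} n) (Rd : Reading p K N) :
    Terminates N Rd (Regime.mohWindowSurfaceTame (p := p) (K := K)) := by
  intro r hr
  let M : ℕ → Multiset ℕ := fun k =>
    ((hr k).sing_finite.toFinset.val).map fun ξ =>
      (residualOrder (r.E k).b ((r.A k).Z.presheaf.stalk ξ) (stalkIdeal (r.E k).J ξ)).toNat
  have hlt : ∀ k, Multiset.IsDershowitzMannaLT (M (k + 1)) (M k) := by
    intro k
    have key : ∀ (E₁ : IdealExponent (r.A (k + 1)).Z) (h₁ : Regime.mohWindowSurfaceTame (r.A (k + 1)) E₁),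
        E₁ = (r.step k).E' →
        Multiset.IsDershowitzMannaLT
          ((h₁.sing_finite.toFinset.val).map fun ξ =>
            (residualOrder E₁.b ((r.A (k + 1)).Z.presheaf.stalk ξ) (stalkIdeal E₁.J ξ)).toNat)
          (M k) := by
      intro E₁ h₁ heq
      subst heq
      exact (r.step k).isDershowitzMannaLT_of_mohWindowSurfaceTame (hr k) h₁
    exact key (r.E (k + 1)) (hr (k + 1)) (r.E_succ k)
  exact false_of_descending_chain Multiset.wellFounded_isDershowitzMannaLT M hlt

/-- [OURS · L1 W4.6 rung (iii-2)] **The rung `MohWindowSurfaceTameTerminates` holds** (every prime `p`, every field `K` of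
characteristic `p`). [folklore] -/
theorem mohWindowSurfaceTameTerminates_holds (p : ℕ) [Fact p.Prime] (K : Type u) [Field K] [CharP K p] :
    MohWindowSurfaceTameTerminates p K :=
  fun _ N Rd => terminates_mohWindowSurfaceTame N Rd

/-- [OURS · L1 W4.6 rung (iii-2)] **The ∇-centred twin `MohWindowSurfaceTameTerminatesNabla` holds**. [folklore] -/
theorem mohWindowSurfaceTameTerminatesNabla_holds (p : ℕ) [Fact p.Prime] (K : Type u) [Field K] [CharP K p] :
    MohWindowSurfaceTameTerminatesNabla p K :=
  mohWindowSurfaceTameTerminatesNabla_of_terminates (mohWindowSurfaceTameTerminates_holds p K)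

/-- [OURS · L1 W4.6 rung (iii-2)] **The perfect-base-field slice `MohWindowSurfaceTameTerminatesPerfect` holds** (res-L1-type-o1's
`…Perfect.lean`, OURS-desk #117 repair (i): over a perfect `K` «no κ-rational heavy root» is «no heavy root»). [folklore] -/
theorem mohWindowSurfaceTameTerminatesPerfect_holds (p : ℕ) [Fact p.Prime] (K : Type u) [Field K] [CharP K p] [PerfectField K] :
    MohWindowSurfaceTameTerminatesPerfect p K :=
  mohWindowSurfaceTameTerminatesPerfect_iff.mpr (mohWindowSurfaceTameTerminates_holds p K)

/-- [OURS · L1 W4.6 rung (iii-2)] **The perfect-base-field ∇-twin `MohWindowSurfaceTameTerminatesNablaPerfect` holds**. [folklore] -/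
theorem mohWindowSurfaceTameTerminatesNablaPerfect_holds (p : ℕ) [Fact p.Prime] (K : Type u) [Field K] [CharP K p]
    [PerfectField K] : MohWindowSurfaceTameTerminatesNablaPerfect p K :=
  mohWindowSurfaceTameTerminatesNablaPerfect_of_terminates (mohWindowSurfaceTameTerminatesPerfect_holds p K)

end Proof

end CampaignW46

end Summit.ResolutionOfSingularities.ResolutionOfSingularities.Theorems

end
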